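import Summits.QuantumFields.BalabanUV.Gaps.D4WalkModelFull

/-!
# Spine/NE5/TwoRunPencilFullModel — NE5's two-run pencil through g1-p2's FULL MODEL TERM (local Γ-kernel, precision `1 + H`,
# Neumann covariance): the pencil of two full model terms on a shared skeleton IS a full model term over `E × ℂ`, letters
# `λ_• ↦ (1 + τr_•)λ_•` (cell `pub-balaban-gaps`, seat `ne5` gen 7; companion of `Spine/NE5/TwoRunPencilParametrix`)

WHY.  `Gaps.D4WalkModelFull` (g1-p2 GEN 4) is the «all three mechanisms» model of row (D4)'s NODE O: a term datum
`FullModelTerm` with LOCAL data `G` (Γ-kernel) and `H` (precision direction, `A = 1 + H`), `TermWalkData` with ONE package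
from the letters `λ_G, λ_H` of `LocalTerms.IsLocal` (`FullModelTerm.termWalkData`), (v)⁺ across tori (`acrossSmall_full`).  As
in `TwoRunPencilParametrix` for the parametrix model, row NE5's residual (r7) wants the two runs' terms as END MEMBERS OF ONE
HOLOMORPHIC PENCIL with letters uniform on the reach disc; here for the full model: run A's term `t`, run B's local
COEFFICIENTS `coefGB`, `coefHB` on the SAME skeletons (sites, located pairs, monomials, entry patterns — (x4)), close at
rates `r_G`, `r_H` (`‖coef^B_b(u) − coef^A_b(u)‖ ≤ r·λ` — rows NE2∕NE3's LOCAL rate in the (1.11) letter), give ONE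
`FullModelTerm` over `E × ℂ` (`pencilTerm`; reference point `(0,0)` = run A) whose local data satisfy `IsLocal` with
`λ_G(1 + τr_G)`, `λ_H(1 + τr_H)` (`isLocal_pencil`), so `FullModelTerm.termWalkData` applies BY NAME (`termWalkData_pencil`):
one torus-free package for the whole pencil, Neumann margin at the inflated `λ_H`.

HONEST FRAMING.  Model bookkeeping over g1-p2's landed datum; run A's term, run B's coefficients, the rates and every letter
are HYPOTHESES; nothing of Bałaban's constructed; NE5 NOT PRINTED ∕ NOT PROVED; leaves 0∕12; (D4) 0∕1; spine 0∕9.  Rung (B)+1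
on a FIXED finite T⁴ — NOT continuum, NOT infinite volume, NOT mass gap, NOT Clay.  0 sorry.

Sources: [B9] = T. Bałaban, CMP **99** (1985) [Balaban1985BackgroundPropagators] Thm 3.10 (3.107)–(3.108) p. 416, (3.130)
p. 422; [II] = CMP **116** (1988) [Balaban1988RG2Cluster] (1.5) p. 3, (1.11) p. 5, p. 13, p. 15.  Nothing here is a claim about
the Yang–Mills mass gap.
-/

noncomputable section

namespace Summit.QuantumFields.BalabanUV.T4Continuum.Spine.NE5.TwoRunPencilFullModel

open Metric Set Finset
open Literature.MathematicalPhysics.QuantumFieldTheory.Balaban1983to89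
open Literature.MathematicalPhysics.QuantumFieldTheory.Balaban1983to89.TreeLengthTorus (TPt)
open Literature.MathematicalPhysics.QuantumFieldTheory.Balaban1983to89.B5TorusCover (UT)
open Literature.MathematicalPhysics.QuantumFieldTheory.Balaban1983to89.B9Thm34Ext (toB6)
open Literature.MathematicalPhysics.QuantumFieldTheory.Balaban1983to89.B9Thm37GlueTorus (torusGeom tdist1)
open Literature.MathematicalPhysics.QuantumFieldTheory.Balaban1983to89.B11SectG (RowSum)
open Literature.MathematicalPhysics.QuantumFieldTheory.Balaban1983to89.B13TermWalkData (TermWalkData)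
open Literature.MathematicalPhysics.QuantumFieldTheory.Balaban1983to89.B13LocalKernelWalks (LocalTerms)
open Summit.QuantumFields.BalabanUV.Gaps.D4WalkModelFull (FullModelTerm)

variable {d N' : ℕ} {ν : ℕ} {Nf : Fin ν → ℕ} [∀ i, NeZero (Nf i)]
variable {E : Type*} [NormedAddCommGroup E] [NormedSpace ℂ E]

/-! ## §1. Local data over `E × ℂ`: the pencil of coefficients (data) and its `IsLocal` -/

section Local

variable {p n : Type}

/-- A (1.11)-shape local datum transported to the configuration space `E × ℂ` with the PENCIL of coefficient functions
`(u, z) ↦ coef_A b u + (τ∕R)z·(coef_B b u − coef_A b u)` (sites, located pairs, monomials, entry patterns kept).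
[cite: Balaban1988RG2Cluster, (1.11) p.5, (1.5) p.3] -/
def pencilLocal (L : LocalTerms d N' ν Nf p n E) (coefB : L.B → E → ℂ) (τ R : ℝ) : LocalTerms d N' ν Nf p n (E × ℂ) where
  B := L.B
  instFintype := L.instFintype
  x := L.x
  y := L.y
  J := L.J
  coef := fun b v => L.coef b v.1 + (((τ / R : ℝ) : ℂ) * v.2) * (coefB b v.1 - L.coef b v.1)
  M := L.M

variable (L : LocalTerms d N' ν Nf p n E) (coefB : L.B → E → ℂ) (τ R : ℝ)

/-- At pencil parameter `z` with `(τ∕R)z` read as `t`, the pencil datum's kernel is the pencil of the kernels: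
`K(σ,(u,z)) = K_A(σ,u) + t·(K_B(σ,u) − K_A(σ,u))`, `K_B` the kernel of run A's datum with coefficients `coefB`.
[cite: Balaban1985BackgroundPropagators, (3.107) p.416] -/
theorem kernel_pencilLocal (σ : TPt d N' → ℂ) (v : E × ℂ) :
    (pencilLocal L coefB τ R).kernel σ v =
      L.kernel σ v.1 + (((τ / R : ℝ) : ℂ) * v.2) •
        (({ L with coef := coefB } : LocalTerms d N' ν Nf p n E).kernel σ v.1 - L.kernel σ v.1) := by
  show (∑ b : L.B, ((∏ j ∈ L.J b, σ j) * (L.coef b v.1 + (((τ / R : ℝ) : ℂ) * v.2) * (coefB b v.1 - L.coef b v.1))) • L.M b)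
    = (∑ b : L.B, ((∏ j ∈ L.J b, σ j) * L.coef b v.1) • L.M b) + (((τ / R : ℝ) : ℂ) * v.2) •
        ((∑ b : L.B, ((∏ j ∈ L.J b, σ j) * coefB b v.1) • L.M b) - ∑ b : L.B, ((∏ j ∈ L.J b, σ j) * L.coef b v.1) • L.M b)
  rw [← Finset.sum_sub_distrib, Finset.smul_sum, ← Finset.sum_add_distrib]
  refine Finset.sum_congr rfl fun b _ => ?_
  rw [← sub_smul, smul_smul, ← add_smul]
  congr 1
  ring

/-- At the reference point `(u, z) = (0, 0)` the pencil datum's kernel is run A's. [folklore] -/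
theorem kernel_pencilLocal_zero (σ : TPt d N' → ℂ) : (pencilLocal L coefB τ R).kernel σ 0 = L.kernel σ 0 := by
  rw [kernel_pencilLocal]
  simp

omit [∀ i, NeZero (Nf i)] [NormedSpace ℂ E] in
/-- On the `R`-ball of `E × ℂ` (sup norm) the first coordinate is in the `R`-ball of `E`. [folklore] -/
private theorem fst_mem_ball {v : E × ℂ} (hv : v ∈ ball (0 : E × ℂ) R) : v.1 ∈ ball (0 : E) R := by
  rw [mem_ball_zero_iff] at hv ⊢
  exact (norm_fst_le v).trans_lt hv

omit [∀ i, NeZero (Nf i)] [NormedSpace ℂ E] in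
/-- On the `R`-ball of `E × ℂ` the rescaled second coordinate has norm `≤ τ` (`τ ≥ 0`). [folklore] -/
private theorem norm_coef_le (hτ : 0 ≤ τ) {v : E × ℂ} (hv : v ∈ ball (0 : E × ℂ) R) :
    ‖((τ / R : ℝ) : ℂ) * v.2‖ ≤ τ := by
  rw [mem_ball_zero_iff] at hv
  have hR : 0 < R := (norm_nonneg v).trans_lt hv
  have h2 : ‖v.2‖ ≤ R := (norm_snd_le v).trans hv.le
  rw [norm_mul, Complex.norm_real, Real.norm_of_nonneg (div_nonneg hτ hR.le)]
  calc τ / R * ‖v.2‖ ≤ τ / R * R := by gcongr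
    _ = τ := div_mul_cancel₀ τ hR.ne'

/-- **`IsLocal` ALONG THE PENCIL**: run A's locality letters `(R, λ, r, m_J, n_B)`, run B's coefficient analyticity and the
closeness `‖coef_B − coef_A‖ ≤ r₀·λ` on the `R`-ball give `IsLocal` for the pencil datum on the `R`-ball of `E × ℂ` with
`λ ↦ (1 + τr₀)λ`, every other letter unchanged (print's (1.5): *"operators … satisfying the same bounds"*).
[cite: Balaban1988RG2Cluster, (1.5) p.3, (1.11) p.5, p.15] -/
theorem isLocal_pencil {c : B13.Consts} {locp : p → UT Nf} {locn : n → UT Nf} {X : Finset (UT Nf)} {lam r r₀ : ℝ}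
    {mJ nB : ℕ} (hτ : 0 ≤ τ) (hL : L.IsLocal c locp locn X R lam r mJ nB)
    (hBan : ∀ b, DifferentiableOn ℂ (coefB b) (ball (0 : E) R))
    (hdiff : ∀ b, ∀ u ∈ ball (0 : E) R, ‖coefB b u - L.coef b u‖ ≤ r₀ * lam) :
    (pencilLocal L coefB τ R).IsLocal c locp locn X R ((1 + τ * r₀) * lam) r mJ nB where
  hMle := hL.hMle
  hMsupp := hL.hMsupp
  hcoef_an b := by
    have hmaps : MapsTo (fun v : E × ℂ => v.1) (ball (0 : E × ℂ) R) (ball (0 : E) R) := fun v hv => fst_mem_ball R hv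
    have h1 : DifferentiableOn ℂ (fun v : E × ℂ => L.coef b v.1) (ball (0 : E × ℂ) R) :=
      (hL.hcoef_an b).comp differentiableOn_fst hmaps
    have h2 : DifferentiableOn ℂ (fun v : E × ℂ => coefB b v.1) (ball (0 : E × ℂ) R) :=
      (hBan b).comp differentiableOn_fst hmaps
    have hc : DifferentiableOn ℂ (fun v : E × ℂ => ((τ / R : ℝ) : ℂ) * v.2) (ball (0 : E × ℂ) R) :=
      differentiableOn_snd.const_mul _
    exact h1.add (hc.mul (h2.sub h1))
  hcoef_bd b v hv := by
    have hu := fst_mem_ball R hv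
    show ‖L.coef b v.1 + (((τ / R : ℝ) : ℂ) * v.2) * (coefB b v.1 - L.coef b v.1)‖ ≤ (1 + τ * r₀) * lam
    have hA := hL.hcoef_bd b v.1 hu
    calc ‖L.coef b v.1 + (((τ / R : ℝ) : ℂ) * v.2) * (coefB b v.1 - L.coef b v.1)‖
        ≤ ‖L.coef b v.1‖ + ‖(((τ / R : ℝ) : ℂ) * v.2) * (coefB b v.1 - L.coef b v.1)‖ := norm_add_le _ _
      _ = ‖L.coef b v.1‖ + ‖((τ / R : ℝ) : ℂ) * v.2‖ * ‖coefB b v.1 - L.coef b v.1‖ := by rw [norm_mul]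
      _ ≤ lam + τ * (r₀ * lam) := by
          gcongr
          · exact norm_coef_le τ R hτ hv
          · exact hdiff b v.1 hu
      _ = (1 + τ * r₀) * lam := by ring
  hrange := hL.hrange
  hJ := hL.hJ
  hX := hL.hX
  hmult := hL.hmult

end Local

/-! ## §2. The pencil of two full model terms is a full model term over `E × ℂ` -/

variable (t : FullModelTerm d N' ν Nf E) (coefGB : t.G.B → E → ℂ) (coefHB : t.H.B → E → ℂ) (τ R : ℝ)

/-- **THE PENCIL TERM**: run A's full model term `t`, run B's local coefficients for the Γ-kernel (`coefGB`) and the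
precision direction (`coefHB`) on the SAME skeletons, as ONE full model term over `E × ℂ`; the reference values at
`(σ,(u,z)) = (0,(0,0))` are run A's, so the reality fields hold (`kernel_pencilLocal_zero`).  (`reducible`.)
[cite: Balaban1988RG2Cluster, (1.5) p.3, (1.11) p.5, p.15] -/
@[reducible] def pencilTerm : FullModelTerm d N' ν Nf (E × ℂ) where
  Λ := t.Λ
  C₀ := t.C₀
  locΛ := t.locΛ
  locN := t.locN
  X := t.X
  m := t.m
  hfib := t.hfib
  G := pencilLocal t.G coefGB τ R
  H := pencilLocal t.H coefHB τ R
  hrealG i j := by rw [kernel_pencilLocal_zero]; exact t.hrealG i j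
  hrealH i j := by rw [kernel_pencilLocal_zero]; exact t.hrealH i j

/-- The pencil term's real reference precision direction is run A's. [folklore] -/
theorem refH_pencil : (pencilTerm t coefGB coefHB τ R).refH = t.refH := by
  show ((pencilLocal t.H coefHB τ R).kernel 0 0).map Complex.re = (t.H.kernel 0 0).map Complex.re
  rw [kernel_pencilLocal_zero]

variable {t coefGB coefHB τ R}

/-- **ONE WALK PACKAGE FOR THE WHOLE TWO-RUN PENCIL OF THE FULL MODEL** (g1-p2's `FullModelTerm.termWalkData` on `pencilTerm`
BY NAME): run A's locality letters for `G` and `H`, run B's coefficient analyticity and closeness at rates `r_G`, `r_H`, and the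
same rates ∕ row sum ∕ positivity input as `FullModelTerm.termWalkData` — with `λ_G ↦ (1 + τr_G)λ_G`, `λ_H ↦ (1 + τr_H)λ_H` in
the package and in the Neumann margin — give `TermWalkData` for the pencil term's kernels with a torus-free package; with
`τ = s∕r` the letters are `(1 + s)λ_•`, free of the two-run rate. [cite: Balaban1985BackgroundPropagators, Thm 3.10 p.416, (3.130) p.422; Balaban1988RG2Cluster, (1.5) p.3, p.13, p.15, p.17] -/
theorem termWalkData_pencil {c : B13.Consts} {lamG lamH r rG rH : ℝ} {mJ nB : ℕ} (hτ : 0 ≤ τ)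
    (hG : t.G.IsLocal c t.locΛ t.locN t.X R lamG r mJ nB) (hH : t.H.IsLocal c t.locΛ t.locΛ t.X R lamH r mJ nB)
    (hGBan : ∀ b, DifferentiableOn ℂ (coefGB b) (ball (0 : E) R))
    (hGdiff : ∀ b, ∀ u ∈ ball (0 : E) R, ‖coefGB b u - t.G.coef b u‖ ≤ rG * lamG)
    (hHBan : ∀ b, DifferentiableOn ℂ (coefHB b) (ball (0 : E) R))
    (hHdiff : ∀ b, ∀ u ∈ ball (0 : E) R, ‖coefHB b u - t.H.coef b u‖ ≤ rH * lamH)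
    (hκ₁ : 0 ≤ c.κ₁) (hlamG : 0 ≤ lamG) (hlamH : 0 ≤ lamH) (hrG : 0 ≤ rG) (hrH : 0 ≤ rH)
    {ρ₀ ε₀ κ₀ μ cμ Rσ : ℝ} (hμ : 0 ≤ μ) (hμκ : 2 * μ ≤ κ₀)
    (hμε : 2 * μ ≤ ε₀) (hwin : κ₀ + μ ≤ ρ₀ - ε₀) (hcμ : 0 ≤ cμ) (hrow : RowSum (toB6 (torusGeom Nf 0 0 0) 0 True) μ cμ)
    (hq : (t.m * cμ) * ((t.m * cμ) * 1 *
      (1 * ((((1 + τ * rH) * lamH) * Real.exp (c.κ₁ * mJ) * Real.exp (ρ₀ * r)) * (nB * cμ))) * cμ) * cμ < 1)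
    (hpos : ((1 : Matrix t.Λ t.Λ ℝ) + t.refH).PosDef)
    (hfar : ∀ b : t.Λ, ∀ z ∈ t.X, Rσ ≤ tdist1 Nf (t.locΛ b) z) :
    TermWalkData ((pencilTerm t coefGB coefHB τ R).toKernels c (by rw [refH_pencil]; exact hpos))
      ⟨R, ε₀, κ₀ - 2 * μ, (((1 + τ * rG) * lamG) * Real.exp (c.κ₁ * mJ) * Real.exp (ρ₀ * r)) * (nB * cμ),
        1 + (((1 + τ * rH) * lamH) * Real.exp (c.κ₁ * mJ) * Real.exp (ρ₀ * r)) * (nB * cμ),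
        1 * (1 - (t.m * cμ) * ((t.m * cμ) * 1 *
          (1 * ((((1 + τ * rH) * lamH) * Real.exp (c.κ₁ * mJ) * Real.exp (ρ₀ * r)) * (nB * cμ))) * cμ) * cμ)⁻¹, Rσ⟩ :=
  FullModelTerm.termWalkData (t := pencilTerm t coefGB coefHB τ R)
    (isLocal_pencil t.G coefGB τ R hτ hG hGBan hGdiff) (isLocal_pencil t.H coefHB τ R hτ hH hHBan hHdiff) hκ₁
    (mul_nonneg (by positivity) hlamG) (mul_nonneg (by positivity) hlamH) hμ hμκ hμε hwin hcμ hrow hq _ hfar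

end Summit.QuantumFields.BalabanUV.T4Continuum.Spine.NE5.TwoRunPencilFullModel

end
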